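import Literature.IUT.LogThetaLattice.PacketLogVolumesProofs
import Literature.IUT.LogVolume.PrincipalArithmeticDivisors
import HarnessLib

/-!
# [IUTchIII] Proposition 3.9 (iii) indexed by `v_ℚ ∈ 𝕍_ℚ` AS PRINTED: packets of places `v | v_ℚ`, the
# global log-volume as "`Σ_{v_ℚ}` of the packet log-volumes", and its invariance under `F^×` from the
# product formula (abc-iut cell, layer L6 ↔ campaign S)

S. Mochizuki, *Inter-universal Teichmüller theory III*, kurims manuscript (May 2020), §3, Proposition
3.9 (iii), p. 117 [claim: Mochizuki2012, status: disputed]: "`𝓘^ℚ(^A𝓕_{𝕍_ℚ}) := ∏_{v_ℚ ∈ 𝕍_ℚ} 𝓘^ℚ(^A𝓕_{v_ℚ})`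
… `𝕄(𝓘^ℚ(^A𝓕_{𝕍_ℚ})) ⊆ ∏_{v_ℚ ∈ 𝕍_ℚ} 𝕄(𝓘^ℚ(^A𝓕_{v_ℚ}))` the subset of elements whose components, indexed by
`v_ℚ ∈ 𝕍_ℚ`, have zero log-volume for all but finitely many `v_ℚ`. Then by adding the log-volumes of
(i) [all but finitely many of which are zero!] at the various `v_ℚ ∈ 𝕍_ℚ`, one obtains a global
log-volume `μ^log_{A,𝕍_ℚ} : 𝕄(𝓘^ℚ(^A𝓕_{𝕍_ℚ})) → ℝ` which is invariant with respect to multiplication by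
elements of `(†𝕄⊛_mod)_α` … the global log-volume `μ^log_{A,𝕍_ℚ}(𝔍)` is equal to the degree of the
arithmetic line bundle determined by `𝔍` … relative to a suitable normalization."

The statement file `PacketLogVolumes.lean` (abc-iut-L6-t4) types the data `GlobalRegion μlog`,
`globalLogVolume μlog` over an ABSTRACT index set `VQ` and predicates `Prop39iii_invariance`,
`Prop39iii_degree`; `PacketLogVolumesPrincipalBridge.lean` (abc-iut-L6-d3) instantiates them with one
region per place of `F`. THIS file instantiates them with the PRINTED indexing: `VQ := 𝕍_ℚ = {∞} ⊔
{primes}` (`RatPlace`), the region at `v_ℚ` being a family of divisor coordinates over the PACKET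
`{v ∈ 𝕍(F) : v | v_ℚ}` (`Packet F v_ℚ`, the fibre of `ratPlaceBelow : 𝕍(F) → 𝕍_ℚ`, a FINITE set:
`finite_fiber_ratPlaceBelow`), i.e. the direct-product region `∏_{v | v_ℚ} 𝔭_v^{-c_v}𝒪_v ⊆ ∏_{v|v_ℚ} F_v =
F ⊗_ℚ ℚ_{v_ℚ}` (single label, `|A| = 1`; see "Scope" below), with packet log-volume
`μlog_{v_ℚ}(c) = Σ_{v | v_ℚ} c_v · deg_F(v)` (`packetDivisorLogVolume`).

RESULTS (sorry-free; no file of t4/t5/t16/S2 is edited):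
* `finsum_packet_regroup` — the regrouping identity `Σ_{v_ℚ ∈ 𝕍_ℚ} Σ_{v | v_ℚ} g(v) = Σ_{v ∈ 𝕍(F)} g(v)` for
  finitely supported `g` (every place of `F` lies over exactly one rational place);
* `globalLogVolume_packetRegionOf : μ^log_{𝕍_ℚ}(S_𝔞) = deg_F(𝔞)` — "adding the log-volumes at the various
  `v_ℚ`" of the region of an arithmetic divisor `𝔞` gives its degree ([IUTchIV] Def. 1.9 (i));
* **`prop39iii_invariance_packetModel`** — **IUTchIII:Prop3.9(iii)** invariance clause
  `Prop39iii_invariance (packetDivisorLogVolume F) (packetPrincipalAction F)` HOLDS: multiplication by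
  `f ∈ F^×` shifts the packet log-volume at `v_ℚ` by `−Σ_{v|v_ℚ} ADiv(f)_v·deg_F(v) = Σ_{v|v_ℚ} log‖f‖_v`, and
  these finitely many rational-place contributions sum to `−deg_F(ADiv(f)) = 0` (the tree's
  `degF_principal`, log form of Mathlib's `NumberField.prod_abs_eq_one`), fed into abc-iut-L6-t5's
  `Prop39iii_invariance_of_productFormula`;
* **`prop39iii_degree_packetModel`** — the degree clause `Prop39iii_degree` with `c = 1`, `deg := deg_F`.

Scope / HONEST FRAMING: the model is the single-label case (`^A𝓕_{v_ℚ}` with `|A| = 1`, regions = direct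
products of balls); for a general capsule `A` the tensor packet is a direct sum of number fields
`K_i ⊇ F` ([IUTchIII] Prop. 3.1 (i); `Literature.RingTheory.Etale.piTensorProduct_exists_algEquiv_pi_field`)
and the same computation applies summand-wise with the product formula of each `K_i` — not typed here.
Nothing here constructs `(†𝓕⊛_mod)_α`, a log-shell or a Frobenioid, asserts anything about [IUTchIII]
Cor. 3.12, or takes a side; typed ≠ discharged elsewhere. The mathematics proved is classical
([IUTchIV] Def. 1.9 (i) / [GenEll] §1). [claim: Mochizuki2012, status: disputed] for the quoted sentences.
-/

namespace Literature.IUT.LogThetaLattice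

open Literature.IUT.LogVolume NumberField IsDedekindDomain Finset

universe u

/-- `𝕍_ℚ`: the places of `ℚ` — the archimedean place `∞` and the prime numbers ([IUTchI] §0;
[IUTchIII] Prop. 3.9 (iii) "`v_ℚ ∈ 𝕍_ℚ`"). [claim: Mochizuki2012, status: disputed] -/
abbrev RatPlace : Type := Unit ⊕ Nat.Primes

namespace RatPlace

/-- `∞ ∈ 𝕍_ℚ`. [claim: Mochizuki2012, status: disputed] -/
abbrev infty : RatPlace := Sum.inl ()

/-- The rational prime `p` as an element of `𝕍_ℚ`. [claim: Mochizuki2012, status: disputed] -/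
abbrev prime (p : Nat.Primes) : RatPlace := Sum.inr p

end RatPlace

variable (F : Type u) [Field F] [NumberField F]

/-! ### `v ↦ v_ℚ`: the rational place under a place of `F`, and the packets `{v | v_ℚ}` -/

/-- The rational place `v_ℚ ∈ 𝕍_ℚ` lying under `v ∈ 𝕍(F)`: `∞` under an archimedean place, the residue
characteristic `p_v` under a finite place. [claim: Mochizuki2012, status: disputed] -/
noncomputable def ratPlaceBelow : Place F → RatPlace
  | Sum.inl _ => RatPlace.infty
  | Sum.inr v => RatPlace.prime ⟨residueChar F v, residueChar_prime F v⟩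

omit [NumberField F] in
/-- An archimedean place lies over `∞`. [claim: Mochizuki2012, status: disputed] -/
@[simp] theorem ratPlaceBelow_inl (w : InfinitePlace F) : ratPlaceBelow F (Sum.inl w) = RatPlace.infty :=
  rfl

omit [NumberField F] in
/-- A finite place lies over its residue characteristic. [claim: Mochizuki2012, status: disputed] -/
@[simp] theorem ratPlaceBelow_inr (v : HeightOneSpectrum (𝓞 F)) :
    ratPlaceBelow F (Sum.inr v) = RatPlace.prime ⟨residueChar F v, residueChar_prime F v⟩ :=
  rfl

/-- A finite place `v` lies over the prime `p` iff `v ∈ V(F)_p` (`placesOver F p`).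
[claim: Mochizuki2012, status: disputed] -/
theorem ratPlaceBelow_inr_eq_prime_iff (v : HeightOneSpectrum (𝓞 F)) (p : Nat.Primes) :
    ratPlaceBelow F (Sum.inr v) = RatPlace.prime p ↔ v ∈ placesOver F (p : ℕ) := by
  haveI : Fact (p : ℕ).Prime := ⟨p.2⟩
  rw [mem_placesOver_iff_residueChar, ratPlaceBelow_inr]
  constructor
  · intro h
    exact congrArg Subtype.val (Sum.inr_injective h)
  · intro h
    exact congrArg Sum.inr (Subtype.ext h)

/-- **Packets are finite**: only finitely many places of `F` lie over a given `v_ℚ ∈ 𝕍_ℚ` (finitely many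
archimedean places; finitely many primes of `𝒪_F` over `p`). [claim: Mochizuki2012, status: disputed] -/
theorem finite_fiber_ratPlaceBelow (q : RatPlace) : {v : Place F | ratPlaceBelow F v = q}.Finite := by
  rcases q with ⟨⟨⟩⟩ | p
  · refine (Set.finite_range (Sum.inl : InfinitePlace F → Place F)).subset ?_
    rintro (w | v) h
    · exact ⟨w, rfl⟩
    · simp [ratPlaceBelow] at h
  · refine (((placesOver F (p : ℕ)).finite_toSet).image Sum.inr).subset ?_
    rintro (w | v) h
    · simp [ratPlaceBelow] at h
    · exact ⟨v, (ratPlaceBelow_inr_eq_prime_iff F v p).mp h, rfl⟩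

/-- The PACKET of places of `F` over `v_ℚ`: `{v ∈ 𝕍(F) : v | v_ℚ}` (the index set of the direct product
`∏_{v | v_ℚ} F_v = F ⊗_ℚ ℚ_{v_ℚ}`). [claim: Mochizuki2012, status: disputed] -/
abbrev Packet (q : RatPlace) : Type u := {v : Place F // ratPlaceBelow F v = q}

/-- Packets are finite types. [claim: Mochizuki2012, status: disputed] -/
instance Packet.instFinite (q : RatPlace) : Finite (Packet F q) :=
  (finite_fiber_ratPlaceBelow F q).to_subtype

/-- (Noncomputable) enumeration of a packet. [claim: Mochizuki2012, status: disputed] -/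
noncomputable instance Packet.instFintype (q : RatPlace) : Fintype (Packet F q) := Fintype.ofFinite _

/-- Every place lies in the packet over the rational place under it. [claim: Mochizuki2012, status: disputed] -/
def Packet.ofPlace (v : Place F) : Packet F (ratPlaceBelow F v) := ⟨v, rfl⟩

/-! ### The packet log-volumes and the global regions -/

/-- **IUTchIII:Prop3.9(iii)** (kurims p.117) datum `μlog_{v_ℚ}` in the packet model: the log-volume of the
direct-product region with divisor coordinates `(c_v)_{v | v_ℚ}` is `Σ_{v | v_ℚ} c_v · deg_F(v)`
(`deg_F(v) = log q_v` resp. `1`, [IUTchIV] Def. 1.9 (i)). [claim: Mochizuki2012, status: disputed] -/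
noncomputable def packetDivisorLogVolume (q : RatPlace) (c : Packet F q → ℝ) : ℝ :=
  ∑ v : Packet F q, c v * degWeight F v.1

/-- `μlog_{v_ℚ}` is additive in the coordinates. [claim: Mochizuki2012, status: disputed] -/
theorem packetDivisorLogVolume_sub (q : RatPlace) (c c' : Packet F q → ℝ) :
    packetDivisorLogVolume F q (fun v => c v - c' v) =
      packetDivisorLogVolume F q c - packetDivisorLogVolume F q c' := by
  simp only [packetDivisorLogVolume, sub_mul, Finset.sum_sub_distrib]

/-- `μlog_{v_ℚ}` vanishes on coordinates that vanish on the packet. [claim: Mochizuki2012, status: disputed] -/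
theorem packetDivisorLogVolume_eq_zero {q : RatPlace} {c : Packet F q → ℝ} (h : ∀ v, c v = 0) :
    packetDivisorLogVolume F q c = 0 := by
  simp [packetDivisorLogVolume, h]

/-- **Regrouping by rational places**: for a finitely supported `g : 𝕍(F) → ℝ`,
`Σ_{v_ℚ ∈ 𝕍_ℚ} Σ_{v | v_ℚ} g(v) = Σ_{v ∈ 𝕍(F)} g(v)` — every place of `F` lies over exactly one rational place
("adding … at the various `v_ℚ ∈ 𝕍_ℚ`" the packet sums gives the sum over all places).
[claim: Mochizuki2012, status: disputed] -/
theorem finsum_packet_regroup (g : Place F → ℝ) (hg : (Function.support g).Finite) :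
    ∑ᶠ q : RatPlace, ∑ v : Packet F q, g v.1 = ∑ᶠ v, g v := by
  classical
  set s : Finset (Place F) := hg.toFinset with hs
  set T : Finset RatPlace := s.image (ratPlaceBelow F) with hT
  have hmem : ∀ v, v ∈ s ↔ g v ≠ 0 := fun v => by rw [hs, Set.Finite.mem_toFinset, Function.mem_support]
  -- the packet sum at `q` is the sum over the part of the support lying over `q`
  have hq : ∀ q, ∑ v : Packet F q, g v.1 = ∑ v ∈ s with ratPlaceBelow F v = q, g v := by
    intro q
    rw [← Finset.sum_subtype_eq_sum_filter]
    refine (Finset.sum_subset (Finset.subset_univ _) fun v _ hv => ?_).symm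
    rw [Finset.mem_subtype] at hv
    by_contra hne
    exact hv ((hmem _).mpr hne)
  have hsupp : (Function.support fun q => ∑ v : Packet F q, g v.1) ⊆ (T : Set RatPlace) := by
    intro q hq'
    rw [Function.mem_support, hq] at hq'
    obtain ⟨v, hv, _⟩ := Finset.exists_ne_zero_of_sum_ne_zero hq'
    rw [Finset.mem_filter] at hv
    rw [Finset.mem_coe, hT, Finset.mem_image]
    exact ⟨v, hv.1, hv.2⟩
  rw [finsum_eq_sum_of_support_subset _ hsupp, finsum_eq_sum_of_support_subset g (s := s)
    (fun v hv => Finset.mem_coe.mpr ((hmem v).mpr hv))]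
  simp_rw [hq]
  exact Finset.sum_fiberwise_of_maps_to (fun v hv => Finset.mem_image_of_mem _ hv) g

/-- The support in `𝕍_ℚ` of the packet sums of a finitely supported `g` is finite (it lies under the
support of `g`). [claim: Mochizuki2012, status: disputed] -/
theorem finite_support_packet_sum (g : Place F → ℝ) (hg : (Function.support g).Finite) :
    (Function.support fun q => ∑ v : Packet F q, g v.1).Finite := by
  refine (hg.image (ratPlaceBelow F)).subset fun q hq => ?_
  obtain ⟨v, -, hv⟩ := Finset.exists_ne_zero_of_sum_ne_zero (Function.mem_support.mp hq)
  exact ⟨v.1, Function.mem_support.mpr hv, v.2⟩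

/-- **IUTchIII:Prop3.9(iii)** (kurims p.117): the global region `S_𝔞 ∈ 𝕄(𝓘^ℚ(^A𝓕_{𝕍_ℚ}))` attached to an
arithmetic divisor `𝔞 = Σ c_v·v` — at `v_ℚ` the direct-product region with coordinates `(c_v)_{v | v_ℚ}`; its
packet log-volumes vanish off the (finite) set of rational places under `Supp(𝔞)`.
[claim: Mochizuki2012, status: disputed] -/
noncomputable def packetRegionOf (a : ADivisor F) : GlobalRegion (packetDivisorLogVolume F) :=
  ⟨fun q v => a v.1, finite_support_packet_sum F (fun v => a v * degWeight F v) <| by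
    refine Set.Finite.subset a.hasFiniteSupport fun v hv => ?_
    exact Function.mem_support.mpr (left_ne_zero_of_mul (Function.mem_support.mp hv))⟩

/-- Coordinates of `S_𝔞`. [claim: Mochizuki2012, status: disputed] -/
@[simp] theorem packetRegionOf_apply (a : ADivisor F) (q : RatPlace) (v : Packet F q) :
    (packetRegionOf F a).1 q v = a v.1 := rfl

/-- **IUTchIII:Prop3.9(iii)** (kurims p.117) "by adding the log-volumes … at the various `v_ℚ ∈ 𝕍_ℚ`": the
global log-volume of `S_𝔞` is the degree `deg_F(𝔞)` of [IUTchIV] Def. 1.9 (i).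
[claim: Mochizuki2012, status: disputed] -/
theorem globalLogVolume_packetRegionOf (a : ADivisor F) :
    globalLogVolume (packetDivisorLogVolume F) (packetRegionOf F a) = degF F a := by
  have hg : (Function.support fun v => a v * degWeight F v).Finite :=
    Set.Finite.subset a.hasFiniteSupport fun v hv =>
      Function.mem_support.mpr (left_ne_zero_of_mul (Function.mem_support.mp hv))
  rw [globalLogVolume]
  change ∑ᶠ q, ∑ v : Packet F q, a v.1 * degWeight F v.1 = _
  rw [finsum_packet_regroup F (fun v => a v * degWeight F v) hg, degF_apply, Finsupp.sum]
  refine finsum_eq_sum_of_support_subset _ fun v hv => ?_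
  simpa only [Finset.mem_coe, Finsupp.mem_support_iff] using left_ne_zero_of_mul hv

/-! ### Multiplication by `f ∈ F^×` and the product formula, packet by packet -/

/-- **IUTchIII:Prop3.9(iii)** (kurims p.117) "multiplication by elements of `(†𝕄⊛_mod)_α`" in the packet
model: `f ∈ F^×` shifts every coordinate `c_v ↦ c_v − ADiv(f)_v` (at `v | p`: `f·𝔭_v^{-c}𝒪_v =
𝔭_v^{-(c − ord_v f)}𝒪_v`; at `v | ∞`: scaling by `|f|_v`). [claim: Mochizuki2012, status: disputed] -/
noncomputable def packetPrincipalAction (f : Fˣ) (S : GlobalRegion (packetDivisorLogVolume F)) :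
    GlobalRegion (packetDivisorLogVolume F) :=
  ⟨fun q v => S.1 q v - ADivisor.principal (f : F) v.1, by
    have h1 := S.2
    have h2 := (packetRegionOf F (ADivisor.principal (f : F))).2
    refine (h1.union h2).subset fun q hq => ?_
    by_contra hq'
    rw [Set.mem_union, not_or, Function.notMem_support, Function.notMem_support] at hq'
    apply Function.mem_support.mp hq
    change packetDivisorLogVolume F q (fun v => S.1 q v - ADivisor.principal (f : F) v.1) = 0
    rw [packetDivisorLogVolume_sub, hq'.1]
    change 0 - packetDivisorLogVolume F q ((packetRegionOf F (ADivisor.principal (f : F))).1 q) = 0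
    rw [hq'.2, sub_zero]⟩

/-- Coordinates of `f·S`. [claim: Mochizuki2012, status: disputed] -/
@[simp] theorem packetPrincipalAction_apply (f : Fˣ) (S : GlobalRegion (packetDivisorLogVolume F))
    (q : RatPlace) (v : Packet F q) :
    (packetPrincipalAction F f S).1 q v = S.1 q v - ADivisor.principal (f : F) v.1 := rfl

/-- The LOCAL (packet) change of log-volume under `f`: `μlog_{v_ℚ}((f·S)_{v_ℚ}) = μlog_{v_ℚ}(S_{v_ℚ}) +
(−Σ_{v|v_ℚ} ADiv(f)_v·deg_F(v))` (`= + Σ_{v | v_ℚ} log‖f‖_v`). [claim: Mochizuki2012, status: disputed] -/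
theorem packetDivisorLogVolume_packetPrincipalAction (f : Fˣ)
    (S : GlobalRegion (packetDivisorLogVolume F)) (q : RatPlace) :
    packetDivisorLogVolume F q ((packetPrincipalAction F f S).1 q) =
      packetDivisorLogVolume F q (S.1 q) +
        -packetDivisorLogVolume F q ((packetRegionOf F (ADivisor.principal (f : F))).1 q) := by
  change packetDivisorLogVolume F q (fun v => S.1 q v - ADivisor.principal (f : F) v.1) = _
  rw [packetDivisorLogVolume_sub, sub_eq_add_neg]
  rfl

/-- **The product formula regrouped by rational places**:
`Σ_{v_ℚ ∈ 𝕍_ℚ} Σ_{v | v_ℚ} ADiv(f)_v · deg_F(v) = deg_F(ADiv(f)) = 0`. [claim: Mochizuki2012, status: disputed] -/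
theorem finsum_packet_principal (f : F) :
    ∑ᶠ q, packetDivisorLogVolume F q ((packetRegionOf F (ADivisor.principal f)).1 q) = 0 := by
  have := globalLogVolume_packetRegionOf F (ADivisor.principal f)
  rwa [degF_principal, globalLogVolume] at this

/-- **IUTchIII:Prop3.9(iii)** (kurims p.117) INVARIANCE CLAUSE DISCHARGED in the packet model indexed by
`𝕍_ℚ` as printed: `Prop39iii_invariance (packetDivisorLogVolume F) (packetPrincipalAction F)` HOLDS —
abc-iut-L6-t5's `Prop39iii_invariance_of_productFormula` fed with the packet-wise local terms and the
product formula `degF_principal` (`finsum_packet_principal`). [claim: Mochizuki2012, status: disputed] -/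
theorem prop39iii_invariance_packetModel :
    Prop39iii_invariance (packetDivisorLogVolume F) (packetPrincipalAction F) :=
  Prop39iii_invariance_of_productFormula (packetDivisorLogVolume F) (packetPrincipalAction F)
    (fun f q => -packetDivisorLogVolume F q ((packetRegionOf F (ADivisor.principal (f : F))).1 q))
    (fun f => by
      simpa only [Function.support_fun_neg] using (packetRegionOf F (ADivisor.principal (f : F))).2)
    (fun f => by rw [finsum_neg_distrib, finsum_packet_principal, neg_zero])
    (fun f S q => packetDivisorLogVolume_packetPrincipalAction F f S q)

/-- The invariance unfolded: `μ^log_{𝕍_ℚ}(f·S) = μ^log_{𝕍_ℚ}(S)`. [claim: Mochizuki2012, status: disputed] -/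
theorem globalLogVolume_packetPrincipalAction (f : Fˣ) (S : GlobalRegion (packetDivisorLogVolume F)) :
    globalLogVolume (packetDivisorLogVolume F) (packetPrincipalAction F f S) =
      globalLogVolume (packetDivisorLogVolume F) S :=
  prop39iii_invariance_packetModel F f S

/-- `f` carries the region of `𝔞` to the region of `𝔞 − ADiv(f)`. [claim: Mochizuki2012, status: disputed] -/
theorem packetPrincipalAction_packetRegionOf (f : Fˣ) (a : ADivisor F) :
    packetPrincipalAction F f (packetRegionOf F a) = packetRegionOf F (a - ADivisor.principal (f : F)) :=
  Subtype.ext (funext fun _ => funext fun _ => rfl)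

/-- **IUTchIII:Prop3.9(iii)** (kurims p.117) DEGREE CLAUSE in the packet model: "the global log-volume … is
equal to the degree of the arithmetic line bundle determined by `𝔍` … relative to a suitable
normalization" — `Prop39iii_degree` HOLDS with objects the arithmetic divisors, `regionOf := S_(−)`,
`deg := deg_F`, `c = 1`. [claim: Mochizuki2012, status: disputed] -/
theorem prop39iii_degree_packetModel :
    Prop39iii_degree (packetDivisorLogVolume F) (packetRegionOf F) (degF F) :=
  ⟨1, one_pos, fun a => by rw [one_mul, globalLogVolume_packetRegionOf]⟩

/-- Line-bundle form: the global log-volume of `S_𝔞` only depends on the class of `𝔞` modulo principal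
divisors — it is the tree's descended degree `degFQuot` on `ADiv_ℝ(F)/APrc(F)` ([GenEll] §1
`ADiv(F)/APrc(F) ⥲ APic(Spec 𝒪_F)`). [claim: Mochizuki2012, status: disputed] -/
theorem globalLogVolume_packetRegionOf_eq_degFQuot (a : ADivisor F) :
    globalLogVolume (packetDivisorLogVolume F) (packetRegionOf F a) =
      degFQuot F (a : ADivisor F ⧸ APrc F) := by
  rw [degFQuot_mk, globalLogVolume_packetRegionOf]

/-- NON-VACUITY: the action moves regions — if `ADiv(f)_v ≠ 0` at some place then `f·S ≠ S`.
[claim: Mochizuki2012, status: disputed] -/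
theorem packetPrincipalAction_ne_self {f : Fˣ} {v : Place F} (hv : ADivisor.principal (f : F) v ≠ 0)
    (S : GlobalRegion (packetDivisorLogVolume F)) : packetPrincipalAction F f S ≠ S := by
  intro h
  have := congrArg (fun T : GlobalRegion (packetDivisorLogVolume F) =>
    T.1 (ratPlaceBelow F v) (Packet.ofPlace F v)) h
  simp only [packetPrincipalAction_apply, sub_eq_self] at this
  exact hv this

end Literature.IUT.LogThetaLattice
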